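import Literature.AnabelianGeometry.EtaleTheta.Discharge.Sec2HasMuLOfSectionCover
import Literature.AnabelianGeometry.EtaleTheta.Discharge.Sec2AutKDotted
import Literature.AnabelianGeometry.EtaleTheta.Discharge.Sec2BarThetaCommutator
import Literature.AnabelianGeometry.EtaleTheta.Discharge.Sec2SlimPiTpC
import Literature.AnabelianGeometry.EtaleTheta.ThetaCoversTemperedOfHuuSection
import Literature.AnabelianGeometry.EtaleTheta.SettingModelChiDeltaTheta
import Literature.AnabelianGeometry.EtaleTheta.SettingModelChiGroupLevelHolds
import Literature.AnabelianGeometry.EtaleTheta.SettingModelCyclotomeModCensus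
import Literature.AnabelianGeometry.EtaleTheta.SettingModelTateTheta
import Literature.AnabelianGeometry.EtaleTheta.SettingModelTateDeltaTheta
import HarnessLib

/-!
# [EtTh] Rmk. 2.6.1 at the χ-twisted models: the typed antecedent «`Π^tp_X` acts trivially on `Δ_Θ/l·Δ_Θ`» (`hμ`)
# holds there IFF `μ_l ⊆ ℚ_p` — and `HasMuL` / Rmk. 2.6.1 for the R312 cover of record at the Kummer-carrying `χ′`
# (proof-only)

S. Mochizuki, *The étale theta function and its Frobenioid-theoretic manifestations*, Publ. RIMS **45** (2009) [EtTh], §2: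
Rmk. 2.6.1 p. 40 («Suppose, for simplicity, that `K` contains a primitive `l`-th root of unity. Then …»), Def. 2.1 p. 35
(«`Δ̄_Θ ≅ (ℤ/lℤ)(1)`»), §1 p. 12 («`(Ẑ(1) ≅) Δ_Θ`») [cite: MochizukiEtTh2009, Rmk 2.6.1 p.40]; J.-P. Serre, *A course in
arithmetic*, Ch. II §3.1 Prop. 7 (`μ(ℚ_p)`) [cite: Serre1973, Ch. II §3.1 Prop. 7]. Cell abc-iut, layer L2, seat abc-iut-L2-t10
(gen 7), row «HMU @ χ-MODELS ⟺ μ_l ⊆ ℚ_p» (gen 6's natural row (N1), HANDOFF #10). PROOF-ONLY (0 definitions).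

WHY. abc-iut-L2-t2's typed Rmk. 2.6.1 / Cor. 2.9 carry print's «`μ_l ⊆ K`» as `T.HasMuL`; abc-iut-L2-d3's / this seat's
`…_hasMuL` theorems (`Sec2HasMuLOfSetting`, `Sec2HasMuLOfSectionCover` p463007) derive it from the §1-level antecedent
`hμ : ∀ σ a, a ∈ Δ_Θ → θ(σ)·a·θ(σ)⁻¹·a⁻¹ ∈ l·Δ_Θ`. At the untwisted `κ′` `hμ` holds for every `l` (K10 v2). At the χ-twisted
models (`modelχ` / `modelχ′` / `inversionModelχ′` — ONE theta layer `CurveTheta (curveχ)`, abc-iut-L6-d6's `SettingModelChiDeltaTheta`)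
conjugation on `Δ_Θ ≅ Ẑ` IS the cyclotomic character (`conj_cThetaχ`: `g·c^t·g⁻¹ = c^{χ(g)t}`), so:

* §1 `ZHatLevel.exists_pow_eq_aut_apply_mul_inv` / `levelChar_eq_one_of_exists_pow` — for `u ∈ Aut(Ẑ)`: `u(t)·t⁻¹ ∈ Ẑ^l` for all
  `t` iff `χ_l(u) = 1` (`Ker(Ẑ → ℤ/l) = Ẑ^l`, abc-iut-L4's `level_eq_one_iff_exists_pow`);
* §2 **`SettingModel.forall_conj_commutator_mem_lDeltaTheta_modelχ_iff`** — at `modelχ` (and `…_modelχ'_iff`,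
  `…_inversionModelχ'_iff`): `hμ` at level `l ≥ 1` **⟺ `∀ σ ∈ G_{ℚ_p}, χ_l(σ) = 1` ⟺ `l ∣ p − 1 ∨ (p = 2 ∧ l = 2)`** — i.e.
  EXACTLY print's «`μ_l ⊆ K`» at `K = ℚ_p` (abc-iut-w5-d125's `forall_levelChar_chi_eq_one_iff`); the level-`0` clause is FALSE
  (`not_forall_conj_commutator_mem_lDeltaTheta_zero_modelχ`: `χ` is non-trivial at level `p²`); the same `iff` at
  abc-iut-L2-t5's Tate-twisted models `modelχq p i j` (`forall_conj_commutator_mem_lDeltaTheta_modelχq_iff`, via `conj_cThetaχq`);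
* §3 (any `MuTwoSetting`) `temperedCoverDataOfHuuOfSection_hTheta` (`⁅Δ_X,Δ_X⁆·Ker = Δ̄_Θ`-preimage, abc-iut-L2-t11's
  `commutator_sup_barKer`), `…_rmk261` (abc-iut-L2-d3's `rmk261_of`), `…_rmk261_dotted_of_slimX` (⟸ Prop. 2.6 + slim `Π^tp_X`);
* §4 at `χ′`: **`hasMuL_coverOfRecordχ'`** — `HasMuL` for THE R312 cover of record (the `temperedCoverDataOfHuuOfSection` term of
  `nonempty_orbitEmbedding_inversionModelχ'`) for every odd `l ∣ p − 1`; **`exists_orbitEmbedding_hasMuL_rmk261_inversionModelχ'`** —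
  the χ′ CENSUS: `OrbitEmbedding` inhabited ∧ `HasMuL` ∧ Rmk. 2.6.1's four `Aut_K` groups UNCONDITIONALLY for odd `l ∣ p − 1`, the
  dotted Rmk. 2.6.1 ⟸ Prop. 2.6 only; and the honest negative `not_hμ_inversionModelχ'_of_not_dvd` (odd `p`, `l ∤ p − 1`: the
  §1 antecedent FAILS, so the `hμ`-route to `HasMuL` is void there — as in print, which ASSUMES `μ_l ⊆ K`).

HONEST LIMITS: semi-synthetic models (the χ-twisted root with a synthetic cusp; SECTION cusp datum) = consistency evidence for the
typed interface only; `HasMuL` itself is not decided here for `l ∤ p − 1` (only its typed §1 antecedent); nothing of [EtTh] asserted;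
no side taken on [IUTchIII] Cor. 3.12; typed ≠ proved; instantiated ≠ endorsed.
-/

noncomputable section

open CategoryTheory ProfiniteGrp ProfiniteGrp.ProfiniteCompletion

namespace Literature.AnabelianGeometry.EtaleTheta

/-! ## §1. `Ẑ`: `u(t)·t⁻¹` is an `l`-th power iff `χ_l(u) = 1` -/

namespace ZHatLevel

/-- For `u ∈ Aut(Ẑ)` with `χ_n(u) = 1`, `u(t)·t⁻¹` dies in `ℤ/n`, hence is an `n`-th power (`Ker(Ẑ → ℤ/nℤ) = Ẑ^n`).
[cite: RibesZalesskii2010, Thm 2.7.1] -/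
theorem exists_pow_eq_aut_apply_mul_inv (n : ℕ+) (φ : MulAut (completion (GrpCat.of (Multiplicative ℤ))))
    (hφ : levelChar n φ = 1) (t : completion (GrpCat.of (Multiplicative ℤ))) :
    ∃ z : completion (GrpCat.of (Multiplicative ℤ)), z ^ (n : ℕ) = φ t * t⁻¹ := by
  rw [← level_eq_one_iff_exists_pow]
  have h := toAdd_level_aut n φ t
  rw [hφ, one_mul] at h
  rw [map_mul, map_inv, Multiplicative.toAdd.injective h, mul_inv_cancel]

/-- Conversely, if `u(η 1)·(η 1)⁻¹` is an `n`-th power then `χ_n(u) = 1`. [cite: RibesZalesskii2010, Thm 2.7.1] -/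
theorem levelChar_eq_one_of_exists_pow (n : ℕ+) (φ : MulAut (completion (GrpCat.of (Multiplicative ℤ))))
    (h : ∃ z : completion (GrpCat.of (Multiplicative ℤ)), z ^ (n : ℕ) = φ (eta 1) * (eta 1)⁻¹) :
    levelChar n φ = 1 := by
  rw [← level_eq_one_iff_exists_pow, map_mul, map_inv, mul_inv_eq_one] at h
  rw [levelChar_apply, h, level_eta, toAdd_ofAdd, Int.cast_one]

end ZHatLevel

/-! ## §2. The χ-twisted models: `hμ` ⟺ `χ_l ≡ 1` on `G_{ℚ_p}` ⟺ `μ_l ⊆ ℚ_p` -/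

namespace SettingModel

open Literature.AnabelianGeometry.SemiGraphs ThetaCovers

variable (p : ℕ) [Fact p.Prime]

/-- The commutator of `g ∈ (Π^tp_X)^Θ` with `c^t ∈ Δ_Θ` is `c^{χ(g)t − t}` (abc-iut-L6-d6's `conj_cThetaχ`).
[cite: MochizukiEtTh2009, §1 p.12] -/
theorem conj_commutator_cThetaχ_eq (g : CurveTheta.GTheta (curveχ p)) (t : ZH) :
    g * cThetaχ p t * g⁻¹ * (cThetaχ p t)⁻¹ = cThetaχ p (chi p (CurveTheta.augTheta (curveχ p) g) t * t⁻¹) := by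
  rw [conj_cThetaχ, map_mul, map_inv]

/-- **`χ_l(g) = 1` ⇒ `[g, c^t] ∈ l·Δ_Θ`** at `modelχ`: the commutator is `c^{(χ(g)−1)t} = (c^z)^l`.
[cite: MochizukiEtTh2009, Rmk 2.6.1 p.40] -/
theorem conj_commutator_mem_lDeltaTheta_modelχ_of_levelChar_eq_one (l : ℕ+) (g : CurveTheta.GTheta (curveχ p))
    (hg : ZHatLevel.levelChar l (chi p (CurveTheta.augTheta (curveχ p) g)) = 1)
    {a : CurveTheta.GTheta (curveχ p)} (ha : a ∈ (ThetaSetting.modelχ p).DeltaTheta) :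
    g * a * g⁻¹ * a⁻¹ ∈ (ThetaSetting.modelχ p).lDeltaTheta l := by
  obtain ⟨t, rfl⟩ := exists_cThetaχ_eq_of_mem_ker p ha
  obtain ⟨z, hz⟩ := ZHatLevel.exists_pow_eq_aut_apply_mul_inv l _ hg t
  rw [conj_commutator_cThetaχ_eq, ← hz, map_pow]
  exact ⟨cThetaχ p z, cThetaχ_mem_ker p z, rfl⟩

/-- **`[inr σ, c] ∈ l·Δ_Θ` ⇒ `χ_l(σ) = 1`** at `modelχ` (`c := c^{η 1}` the generator; `cThetaχ` injective, `Δ_Θ = c^Ẑ`).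
[cite: MochizukiEtTh2009, Rmk 2.6.1 p.40] -/
theorem levelChar_chi_eq_one_of_conj_commutator_mem_lDeltaTheta_modelχ (l : ℕ+) (σ : GQp p)
    (h : (ThetaSetting.modelχ p).toTheta (SemidirectProduct.inr σ) * cThetaχ p (ZHatLevel.eta 1) *
        ((ThetaSetting.modelχ p).toTheta (SemidirectProduct.inr σ))⁻¹ * (cThetaχ p (ZHatLevel.eta 1))⁻¹ ∈
      (ThetaSetting.modelχ p).lDeltaTheta l) :
    ZHatLevel.levelChar l (chi p σ) = 1 := by
  obtain ⟨y, hy, hyl⟩ := h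
  obtain ⟨s, rfl⟩ := exists_cThetaχ_eq_of_mem_ker p hy
  have haug : CurveTheta.augTheta (curveχ p) ((ThetaSetting.modelχ p).toTheta (SemidirectProduct.inr σ)) = σ := by
    change CurveTheta.augTheta (curveχ p) (CurveTheta.toTheta (curveχ p) _) = σ
    rw [CurveTheta.augTheta_toTheta]
    rfl
  rw [conj_commutator_cThetaχ_eq, haug, ← map_pow] at hyl
  exact ZHatLevel.levelChar_eq_one_of_exists_pow l _ ⟨s, cThetaχ_injective p hyl⟩

/-- **[EtTh] Rmk. 2.6.1's hypothesis at `modelχ`, EXACTLY: «`Π^tp_X` acts trivially on `Δ_Θ/l·Δ_Θ`» ⟺ `χ_l ≡ 1` on `G_{ℚ_p}`.**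
[cite: MochizukiEtTh2009, Rmk 2.6.1 p.40] -/
theorem forall_conj_commutator_mem_lDeltaTheta_modelχ_iff_levelChar (l : ℕ+) :
    (∀ (σ : (ThetaSetting.modelχ p).PiTemp) (a : (ThetaSetting.modelχ p).GtpTheta), a ∈ (ThetaSetting.modelχ p).DeltaTheta →
        (ThetaSetting.modelχ p).toTheta σ * a * ((ThetaSetting.modelχ p).toTheta σ)⁻¹ * a⁻¹ ∈
          (ThetaSetting.modelχ p).lDeltaTheta l) ↔
      ∀ σ : GQp p, ZHatLevel.levelChar l (chi p σ) = 1 := by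
  constructor
  · intro h σ
    exact levelChar_chi_eq_one_of_conj_commutator_mem_lDeltaTheta_modelχ p l σ (h _ _ (cThetaχ_mem_ker p _))
  · intro h σ a ha
    exact conj_commutator_mem_lDeltaTheta_modelχ_of_levelChar_eq_one p l _ (h _) ha

/-- **[EtTh] Rmk. 2.6.1's hypothesis at `modelχ` ⟺ `μ_l ⊆ ℚ_p`**: «`Π^tp_X` acts trivially on `Δ_Θ/l·Δ_Θ`» ⟺
`l ∣ p − 1 ∨ (p = 2 ∧ l = 2)` (abc-iut-w5-d125's census `forall_levelChar_chi_eq_one_iff`). [cite: MochizukiEtTh2009, Rmk 2.6.1 p.40] -/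
theorem forall_conj_commutator_mem_lDeltaTheta_modelχ_iff (l : ℕ+) :
    (∀ (σ : (ThetaSetting.modelχ p).PiTemp) (a : (ThetaSetting.modelχ p).GtpTheta), a ∈ (ThetaSetting.modelχ p).DeltaTheta →
        (ThetaSetting.modelχ p).toTheta σ * a * ((ThetaSetting.modelχ p).toTheta σ)⁻¹ * a⁻¹ ∈
          (ThetaSetting.modelχ p).lDeltaTheta l) ↔
      (l : ℕ) ∣ p - 1 ∨ (p = 2 ∧ (l : ℕ) = 2) := by
  rw [forall_conj_commutator_mem_lDeltaTheta_modelχ_iff_levelChar, forall_levelChar_chi_eq_one_iff]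

/-- **The level-`0` clause is FALSE at `modelχ`**: `0·Δ_Θ = 1`, while `χ` is non-trivial (abc-iut-w5-d091/w5-d125's
`exists_levelChar_chi_ne_one_of_sq_dvd` at level `p²`), so some `[inr σ, c] ≠ 1`. [cite: MochizukiEtTh2009, Rmk 2.6.1 p.40] -/
theorem not_forall_conj_commutator_mem_lDeltaTheta_zero_modelχ :
    ¬ ∀ (σ : (ThetaSetting.modelχ p).PiTemp) (a : (ThetaSetting.modelχ p).GtpTheta), a ∈ (ThetaSetting.modelχ p).DeltaTheta →
        (ThetaSetting.modelχ p).toTheta σ * a * ((ThetaSetting.modelχ p).toTheta σ)⁻¹ * a⁻¹ ∈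
          (ThetaSetting.modelχ p).lDeltaTheta 0 := by
  intro h
  set N : ℕ+ := ⟨p ^ 2, pow_pos (Fact.out : p.Prime).pos 2⟩ with hN
  obtain ⟨σ, hσ⟩ := exists_levelChar_chi_ne_one_of_sq_dvd p N (dvd_refl _)
  apply hσ
  obtain ⟨y, -, hyl⟩ := h (SemidirectProduct.inr σ) _ (cThetaχ_mem_ker p (ZHatLevel.eta 1))
  have haug : CurveTheta.augTheta (curveχ p) ((ThetaSetting.modelχ p).toTheta (SemidirectProduct.inr σ)) = σ := by
    change CurveTheta.augTheta (curveχ p) (CurveTheta.toTheta (curveχ p) _) = σ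
    rw [CurveTheta.augTheta_toTheta]
    rfl
  rw [pow_zero, conj_commutator_cThetaχ_eq, haug, ← map_one (cThetaχ p)] at hyl
  have h1 : chi p σ (ZHatLevel.eta 1) = ZHatLevel.eta 1 := by
    rw [← mul_inv_eq_one]; exact (cThetaχ_injective p hyl).symm
  rw [ZHatLevel.levelChar_apply, h1, ZHatLevel.level_eta, toAdd_ofAdd, Int.cast_one]

/-- The total statement over `l : ℕ` at `modelχ`: «`Π^tp_X` acts trivially on `Δ_Θ/l·Δ_Θ`» ⟺ `l ∣ p − 1 ∨ (p = 2 ∧ l = 2)`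
(`l = 0`: both sides false, `p − 1 ≥ 1`). [cite: MochizukiEtTh2009, Rmk 2.6.1 p.40] -/
theorem forall_conj_commutator_mem_lDeltaTheta_modelχ_iff_nat (l : ℕ) :
    (∀ (σ : (ThetaSetting.modelχ p).PiTemp) (a : (ThetaSetting.modelχ p).GtpTheta), a ∈ (ThetaSetting.modelχ p).DeltaTheta →
        (ThetaSetting.modelχ p).toTheta σ * a * ((ThetaSetting.modelχ p).toTheta σ)⁻¹ * a⁻¹ ∈
          (ThetaSetting.modelχ p).lDeltaTheta l) ↔
      l ∣ p - 1 ∨ (p = 2 ∧ l = 2) := by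
  rcases Nat.eq_zero_or_pos l with rfl | hl
  · refine ⟨fun h => (not_forall_conj_commutator_mem_lDeltaTheta_zero_modelχ p h).elim, fun h => ?_⟩
    rcases h with h | ⟨-, h⟩
    · have h2 := (Fact.out : p.Prime).two_le
      rw [zero_dvd_iff] at h
      omega
    · exact absurd h (by norm_num)
  · exact forall_conj_commutator_mem_lDeltaTheta_modelχ_iff p ⟨l, hl⟩

/-! ### The cusped twin `modelχ′` and abc-iut-w5-d140's `inversionModelχ′` (same theta layer) -/

/-- **At `modelχ′`**: «`Π^tp_X` acts trivially on `Δ_Θ/l·Δ_Θ`» ⟺ `l ∣ p − 1 ∨ (p = 2 ∧ l = 2)` (the theta layer of `modelχ′`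
is `modelχ`'s verbatim). [cite: MochizukiEtTh2009, Rmk 2.6.1 p.40] -/
theorem forall_conj_commutator_mem_lDeltaTheta_modelχ'_iff (l : ℕ) :
    (∀ (σ : (ThetaSetting.modelχ' p).PiTemp) (a : (ThetaSetting.modelχ' p).GtpTheta), a ∈ (ThetaSetting.modelχ' p).DeltaTheta →
        (ThetaSetting.modelχ' p).toTheta σ * a * ((ThetaSetting.modelχ' p).toTheta σ)⁻¹ * a⁻¹ ∈
          (ThetaSetting.modelχ' p).lDeltaTheta l) ↔
      l ∣ p - 1 ∨ (p = 2 ∧ l = 2) :=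
  forall_conj_commutator_mem_lDeltaTheta_modelχ_iff_nat p l

/-- **At `inversionModelχ′`** (the `MuTwoSetting` of the R312 capstone; `toThetaSetting = modelχ′` by `rfl`): the antecedent `hμ`
of this seat's `temperedCoverDataOfHuuOfSection_hasMuL` ⟺ `l ∣ p − 1 ∨ (p = 2 ∧ l = 2)`. [cite: MochizukiEtTh2009, Rmk 2.6.1 p.40] -/
theorem forall_conj_commutator_mem_lDeltaTheta_inversionModelχ'_iff (l : ℕ) :
    (∀ (σ : (MuTwoSetting.inversionModelχ' p).PiTemp) (a : (MuTwoSetting.inversionModelχ' p).GtpTheta),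
        a ∈ (MuTwoSetting.inversionModelχ' p).DeltaTheta →
        (MuTwoSetting.inversionModelχ' p).toTheta σ * a * ((MuTwoSetting.inversionModelχ' p).toTheta σ)⁻¹ * a⁻¹ ∈
          (MuTwoSetting.inversionModelχ' p).lDeltaTheta l) ↔
      l ∣ p - 1 ∨ (p = 2 ∧ l = 2) :=
  forall_conj_commutator_mem_lDeltaTheta_modelχ_iff_nat p l

/-- **`hμ` DISCHARGED at `inversionModelχ′` for `l ∣ p − 1`** (`μ_l ⊆ ℚ_p`, Serre II §3.1). [cite: MochizukiEtTh2009, Rmk 2.6.1 p.40] -/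
theorem hμ_inversionModelχ'_of_dvd_pred {l : ℕ} (hl : l ∣ p - 1) (σ : (MuTwoSetting.inversionModelχ' p).PiTemp)
    (a : (MuTwoSetting.inversionModelχ' p).GtpTheta) (ha : a ∈ (MuTwoSetting.inversionModelχ' p).DeltaTheta) :
    (MuTwoSetting.inversionModelχ' p).toTheta σ * a * ((MuTwoSetting.inversionModelχ' p).toTheta σ)⁻¹ * a⁻¹ ∈
      (MuTwoSetting.inversionModelχ' p).lDeltaTheta l :=
  (forall_conj_commutator_mem_lDeltaTheta_inversionModelχ'_iff p l).mpr (Or.inl hl) σ a ha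

/-- **HONEST NEGATIVE at `inversionModelχ′`**: for odd `p` and `l ∤ p − 1` the §1 antecedent `hμ` FAILS — the `hμ`-route to
`HasMuL` (p463007) is void there, consistent with print (Rmk. 2.6.1 ASSUMES `μ_l ⊆ K`). [cite: MochizukiEtTh2009, Rmk 2.6.1 p.40] -/
theorem not_hμ_inversionModelχ'_of_not_dvd (hp2 : p ≠ 2) {l : ℕ} (hl : ¬ l ∣ p - 1) :
    ¬ ∀ (σ : (MuTwoSetting.inversionModelχ' p).PiTemp) (a : (MuTwoSetting.inversionModelχ' p).GtpTheta),
        a ∈ (MuTwoSetting.inversionModelχ' p).DeltaTheta →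
        (MuTwoSetting.inversionModelχ' p).toTheta σ * a * ((MuTwoSetting.inversionModelχ' p).toTheta σ)⁻¹ * a⁻¹ ∈
          (MuTwoSetting.inversionModelχ' p).lDeltaTheta l := by
  rw [forall_conj_commutator_mem_lDeltaTheta_inversionModelχ'_iff]
  rintro (h | ⟨h, -⟩)
  exacts [hl h, hp2 h]

/-! ### The Tate-twisted models `modelχq` (abc-iut-L2-t5's Kummer lane): the same argument with `conj_cThetaχq` -/

/-- The commutator of `g ∈ (Π^tp_X)^Θ` with `c^t ∈ Δ_Θ` at `curveχq` is `c^{χ(g)t − t}` (abc-iut-L6-d6's `conj_cThetaχq`).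
[cite: MochizukiEtTh2009, §1 p.12] -/
theorem conj_commutator_cThetaχq_eq (i j : ℤ) (g : CurveTheta.GTheta (curveχq p i j)) (t : ZH) :
    g * cThetaχq p i j t * g⁻¹ * (cThetaχq p i j t)⁻¹ =
      cThetaχq p i j (chi p (CurveTheta.augTheta (curveχq p i j) g) t * t⁻¹) := by
  rw [conj_cThetaχq, map_mul, map_inv]

/-- **At the Tate-twisted models `modelχq p i j`**: «`Π^tp_X` acts trivially on `Δ_Θ/l·Δ_Θ`» ⟺ `l ∣ p − 1 ∨ (p = 2 ∧ l = 2)`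
(`Δ_Θ(curveχq) = c^Ẑ` with conjugation `= χ ∘ aug^Θ`, abc-iut-L6-d6's `SettingModelTateDeltaTheta`).
[cite: MochizukiEtTh2009, Rmk 2.6.1 p.40] -/
theorem forall_conj_commutator_mem_lDeltaTheta_modelχq_iff (i j : ℤ) (hj : Even j) (l : ℕ+) :
    (∀ (σ : (ThetaSetting.modelχq p i j hj).PiTemp) (a : (ThetaSetting.modelχq p i j hj).GtpTheta),
        a ∈ (ThetaSetting.modelχq p i j hj).DeltaTheta →
        (ThetaSetting.modelχq p i j hj).toTheta σ * a * ((ThetaSetting.modelχq p i j hj).toTheta σ)⁻¹ * a⁻¹ ∈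
          (ThetaSetting.modelχq p i j hj).lDeltaTheta l) ↔
      (l : ℕ) ∣ p - 1 ∨ (p = 2 ∧ (l : ℕ) = 2) := by
  rw [← forall_levelChar_chi_eq_one_iff]
  have haug : ∀ σ : GQp p,
      CurveTheta.augTheta (curveχq p i j) ((ThetaSetting.modelχq p i j hj).toTheta (SemidirectProduct.inr σ)) = σ := fun σ => by
    change CurveTheta.augTheta (curveχq p i j) (CurveTheta.toTheta (curveχq p i j) _) = σ
    rw [CurveTheta.augTheta_toTheta]
    rfl
  constructor
  · intro h σ
    obtain ⟨y, hy, hyl⟩ := h (SemidirectProduct.inr σ) _ (cThetaχq_mem_ker p i j (ZHatLevel.eta 1))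
    obtain ⟨s, rfl⟩ := exists_cThetaχq_eq_of_mem_ker p i j hy
    rw [conj_commutator_cThetaχq_eq, haug, ← map_pow] at hyl
    exact ZHatLevel.levelChar_eq_one_of_exists_pow l _ ⟨s, cThetaχq_injective p i j hyl⟩
  · intro h σ a ha
    obtain ⟨t, rfl⟩ := exists_cThetaχq_eq_of_mem_ker p i j ha
    obtain ⟨z, hz⟩ := ZHatLevel.exists_pow_eq_aut_apply_mul_inv l _ (h (CurveTheta.augTheta (curveχq p i j) _)) t
    rw [conj_commutator_cThetaχq_eq, ← hz, map_pow]
    exact ⟨cThetaχq p i j z, cThetaχq_mem_ker p i j z, rfl⟩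

end SettingModel

/-! ## §3. Any `MuTwoSetting`: `hΘ`, Rmk. 2.6.1 (undotted / dotted) for abc-iut-L2-d3's `temperedCoverDataOfHuuOfSection` -/

namespace MuTwoSetting.CLevelData

open Literature.AnabelianGeometry.SemiGraphs ThetaCovers
open Literature.AlgebraicGeometry.Frobenioids (IsSlimGroup)

variable {p : ℕ} [Fact p.Prime] {M : MuTwoSetting p}
variable {PC : Type} [Group PC] [TopologicalSpace PC] [IsTopologicalGroup PC] [T2Space PC]

/-- **`hΘ` for the R312 constructor of record**: `⁅Δ_X, Δ_X⁆ ⊔ Ker(Δ_X ↠ Δ̄_X) = Δ̄_Θ`-preimage for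
`temperedCoverDataOfHuuOfSection` — its `toCoverDataAx` is `coverDataAxOfSection` (`Π_X`, `aug`, `barKer`, `barTheta` of
`I := e.piCDataOf ιC hιC` by `rfl`), so this is abc-iut-L2-t11's `PiCData.commutator_sup_barKer`. [cite: MochizukiEtTh2009, Def 2.1 p.35] -/
theorem temperedCoverDataOfHuuOfSection_hTheta (e : M.CLevelData) (ιC : M.GtpC →ₜ* PC) (hιC : IsProfiniteCompletion ιC)
    (hinj : Function.Injective ιC) (op : M.toThetaSetting.OncePuncturedData) {l : ℕ} (hodd : Odd l)
    (s : ↥M.GK →* M.PiTemp) (hsa : ∀ σ, M.aug (s σ) = (σ : GQp p)) (hsZ : ∀ σ, M.toZ (s σ) = 1)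
    (hιell : ∀ c ∈ (e.piCDataOf ιC hιC).augGK.ker, c ∉ (e.piCDataOf ιC hιC).PiX →
      ∀ d ∈ (e.piCDataOf ιC hιC).PiX ⊓ (e.piCDataOf ιC hιC).augGK.ker,
        c * d * c⁻¹ * d ∈ (e.piCDataOf ιC hιC).barTheta l)
    (hN : ((M.GtpXu l).map M.inclX).Normal) (hY : (M.GtpY.map M.inclX).Normal)
    {E : M.toThetaSetting.EtaleThetaData} (C : E.DoubleUnderline l) (hK : M.barKerTp l ≤ C.Huu)
    (hsH : ∀ σ, s σ ∈ C.Huu) {g : M.GtpC} (hgX : g ∉ M.inclX.range) (hι : C.IotaStable (e.conjX g)) :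
    ⁅(e.temperedCoverDataOfHuuOfSection ιC hιC hinj op hodd s hsa hsZ hιell hN hY C hK hsH hgX hι).DeltaX,
        (e.temperedCoverDataOfHuuOfSection ιC hιC hinj op hodd s hsa hsZ hιell hN hY C hK hsH hgX hι).DeltaX⁆ ⊔
        (e.temperedCoverDataOfHuuOfSection ιC hιC hinj op hodd s hsa hsZ hιell hN hY C hK hsH hgX hι).barKer =
      (e.temperedCoverDataOfHuuOfSection ιC hιC hinj op hodd s hsa hsZ hιell hN hY C hK hsH hgX hι).barTheta :=
  (e.piCDataOf ιC hιC).commutator_sup_barKer l op hodd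

/-- **[EtTh] Rmk. 2.6.1 (undotted) for the R312 constructor of record** `temperedCoverDataOfHuuOfSection` (any `MuTwoSetting`):
given `HasMuL`, `Aut_K(X̲̲) ≅ ℤ/l × ℤ/2`, `Aut_K(X̲) ≅ D_l`, `Aut_K(C̲̲) ≅ ℤ/l`, `Aut_K(C̲) = 1` — abc-iut-L2-d3's `rmk261_of`
fed with `temperedCoverDataOfHuuOfSection_hTheta`. [cite: MochizukiEtTh2009, Rmk 2.6.1 p.40] -/
theorem temperedCoverDataOfHuuOfSection_rmk261 (e : M.CLevelData) (ιC : M.GtpC →ₜ* PC) (hιC : IsProfiniteCompletion ιC)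
    (hinj : Function.Injective ιC) (op : M.toThetaSetting.OncePuncturedData) {l : ℕ} [NeZero l] (hodd : Odd l)
    (s : ↥M.GK →* M.PiTemp) (hsa : ∀ σ, M.aug (s σ) = (σ : GQp p)) (hsZ : ∀ σ, M.toZ (s σ) = 1)
    (hιell : ∀ c ∈ (e.piCDataOf ιC hιC).augGK.ker, c ∉ (e.piCDataOf ιC hιC).PiX →
      ∀ d ∈ (e.piCDataOf ιC hιC).PiX ⊓ (e.piCDataOf ιC hιC).augGK.ker,
        c * d * c⁻¹ * d ∈ (e.piCDataOf ιC hιC).barTheta l)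
    (hN : ((M.GtpXu l).map M.inclX).Normal) (hY : (M.GtpY.map M.inclX).Normal)
    {E : M.toThetaSetting.EtaleThetaData} (C : E.DoubleUnderline l) (hK : M.barKerTp l ≤ C.Huu)
    (hsH : ∀ σ, s σ ∈ C.Huu) {g : M.GtpC} (hgX : g ∉ M.inclX.range) (hι : C.IotaStable (e.conjX g)) :
    (e.temperedCoverDataOfHuuOfSection ιC hιC hinj op hodd s hsa hsZ hιell hN hY C hK hsH hgX hι).Rmk261 :=
  (e.temperedCoverDataOfHuuOfSection ιC hιC hinj op hodd s hsa hsZ hιell hN hY C hK hsH hgX hι).rmk261_of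
    (e.temperedCoverDataOfHuuOfSection_hTheta ιC hιC hinj op hodd s hsa hsZ hιell hN hY C hK hsH hgX hι)

/-- **[EtTh] Rmk. 2.6.1 (dotted) for the R312 constructor of record**, CONDITIONAL on Prop. 2.6 (`T.Prop26`, FACT-LIST F-0610,
BY NAME), with the temp-slimness of `Π^tp_C` DISCHARGED from that of `Π^tp_X` (abc-iut-L2-d3's `isSlimGroup_GtpC`, `l` odd `≠ 1`):
abc-iut-L2-d3's `rmk261_dotted_of`. [cite: MochizukiEtTh2009, Rmk 2.6.1 p.40] -/
theorem temperedCoverDataOfHuuOfSection_rmk261_dotted_of_slimX (e : M.CLevelData) (ιC : M.GtpC →ₜ* PC)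
    (hιC : IsProfiniteCompletion ιC) (hinj : Function.Injective ιC) (op : M.toThetaSetting.OncePuncturedData)
    {l : ℕ} [NeZero l] (hodd : Odd l) (hl : l ≠ 1)
    (s : ↥M.GK →* M.PiTemp) (hsa : ∀ σ, M.aug (s σ) = (σ : GQp p)) (hsZ : ∀ σ, M.toZ (s σ) = 1)
    (hιell : ∀ c ∈ (e.piCDataOf ιC hιC).augGK.ker, c ∉ (e.piCDataOf ιC hιC).PiX →
      ∀ d ∈ (e.piCDataOf ιC hιC).PiX ⊓ (e.piCDataOf ιC hιC).augGK.ker,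
        c * d * c⁻¹ * d ∈ (e.piCDataOf ιC hιC).barTheta l)
    (hN : ((M.GtpXu l).map M.inclX).Normal) (hY : (M.GtpY.map M.inclX).Normal)
    {E : M.toThetaSetting.EtaleThetaData} (C : E.DoubleUnderline l) (hK : M.barKerTp l ≤ C.Huu)
    (hsH : ∀ σ, s σ ∈ C.Huu) {g : M.GtpC} (hgX : g ∉ M.inclX.range) (hι : C.IotaStable (e.conjX g))
    (hX : IsSlimGroup M.PiTemp)
    (h26 : (e.temperedCoverDataOfHuuOfSection ιC hιC hinj op hodd s hsa hsZ hιell hN hY C hK hsH hgX hι).Prop26) :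
    (e.temperedCoverDataOfHuuOfSection ιC hιC hinj op hodd s hsa hsZ hιell hN hY C hK hsH hgX hι).Rmk261_dotted :=
  (e.temperedCoverDataOfHuuOfSection ιC hιC hinj op hodd s hsa hsZ hιell hN hY C hK hsH hgX hι).rmk261_dotted_of
    (e.isSlimGroup_GtpC ιC hιC op hodd hl hιell hX) h26
    (e.temperedCoverDataOfHuuOfSection_hTheta ιC hιC hinj op hodd s hsa hsZ hιell hN hY C hK hsH hgX hι)

end MuTwoSetting.CLevelData

/-! ## §4. At the Kummer-carrying `χ′`: `HasMuL` + Rmk. 2.6.1 for THE R312 cover of record -/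

namespace SettingModel

open Literature.AnabelianGeometry.SemiGraphs ThetaCovers ThetaSetting
open Literature.AlgebraicGeometry.Frobenioids (IsSlimGroup)

variable (p : ℕ) [Fact p.Prime]

/-- **`HasMuL` DISCHARGED for THE R312 cover of record at `χ′`** — the `temperedCoverDataOfHuuOfSection` term of this seat's
`nonempty_orbitEmbedding_inversionModelχ'` (THE completion `toPiCHat`, the Galois section `sectionχ′`, `g := ε_±`; the three
`Prop`-valued inputs `hK`, `hsH`, `hι` arbitrary — proof-irrelevant, so this covers every instance in the tree), for every bundle
`eX` and every odd `l ∣ p − 1`: p463007 fed with `hμ_inversionModelχ'_of_dvd_pred`. [cite: MochizukiEtTh2009, Rmk 2.6.1 p.40] -/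
theorem hasMuL_coverOfRecordχ' {E : (ThetaSetting.modelχ' p).EtaleThetaData} {l : ℕ+} (hodd : Odd (l : ℕ))
    (hl : (l : ℕ) ∣ p - 1) (C : E.DoubleUnderline (l : ℕ)) (eX : (ThetaSetting.modelχ' p).OncePuncturedData)
    (hK : (MuTwoSetting.inversionModelχ' p).barKerTp l ≤ C.Huu) (hsH : ∀ σ, sectionχ' p σ ∈ C.Huu)
    (hι : C.IotaStable ((cLevelDataInvχ' p).conjX (epsPMInvχ p))) :
    ((cLevelDataInvχ' p).temperedCoverDataOfHuuOfSection (cLevelDataInvχ' p).toPiCHat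
      (cLevelDataInvχ' p).isProfiniteCompletion_toPiCHat (cLevelDataInvχ' p).toPiCHat_injective eX hodd (sectionχ' p)
      (aug_sectionχ' p) (toZ_sectionχ' p) (inv_ell_piCData_inversionModelχ' p l eX)
      ((cLevelDataInvχ' p).map_inclX_GtpXu_normal l (kerToZIsCompactlyGenerated_modelχ' p))
      ((cLevelDataInvχ' p).map_inclX_GtpY_normal (kerToZIsCompactlyGenerated_modelχ' p)) C hK hsH
      (epsPMInvχ_not_mem_range p) hι).HasMuL :=
  (cLevelDataInvχ' p).temperedCoverDataOfHuuOfSection_hasMuL _ _ _ eX hodd _ _ _ _ _ _ C hK hsH _ hι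
    (hμ_inversionModelχ'_of_dvd_pred p hl)

/-- **THE χ′ CENSUS for the R312 cover of record.** At the Kummer-carrying cusped inversion model `χ′`, for every odd `l` with
**`l ∣ p − 1`**, every étale-theta datum `E` over `modelχ′`, every `X̲̲` with `Π^tp_{X̲̲} = Huuχ p l` and Def. 1.9 points `τ, τ′`:
a `TemperedCoverData` `T` on THE `Π^tp_C` of `inversionModelχ′` with (i) abc-iut-L2-t2's `OrbitEmbedding C T` INHABITED (R312,
p454259), (ii) **`HasMuL`** (NEW: discharged, not assumed), (iii) **Rmk. 2.6.1 UNCONDITIONALLY** — `Aut_K(X̲̲) ≅ ℤ/l × ℤ/2`,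
`Aut_K(X̲) ≅ D_l`, `Aut_K(C̲̲) ≅ ℤ/l`, `Aut_K(C̲) = 1` — and (iv) the dotted Rmk. 2.6.1 GIVEN ONLY Prop. 2.6 (`l ≠ 1`; slimness of
`Π^tp_X = Γ ⋊_χ G_{ℚ_p}` = abc-iut-w5-d233's `isSlimGroup_PiTpχ_holds`). Residual = {Prop. 2.6 (F-0610), for (iv) only}.
[cite: MochizukiEtTh2009, Rmk 2.6.1 p.40] -/
theorem exists_orbitEmbedding_hasMuL_rmk261_inversionModelχ' {E : (ThetaSetting.modelχ' p).EtaleThetaData} {l : ℕ+}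
    (hodd : Odd (l : ℕ)) (hl1 : (l : ℕ) ≠ 1) (hl : (l : ℕ) ∣ p - 1) (C : E.DoubleUnderline (l : ℕ)) (hC : C.Huu = Huuχ p l)
    (τ τ' : ThetaSetting.NonCuspidalPoint E.toKummerData) :
    ∃ T : TemperedCoverData.{0} l, T.Gtp = (MuTwoSetting.inversionModelχ' p).GtpC ∧ Nonempty (C.OrbitEmbedding T) ∧
      T.HasMuL ∧
      (Nonempty (T.autK (T.tp T.PiXuu) ≃* Multiplicative (ZMod l) × Multiplicative (ZMod 2)) ∧
        Nonempty (T.autK (T.tp T.PiXu) ≃* DihedralGroup l) ∧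
        Nonempty (T.autK (T.tp T.PiCuu) ≃* Multiplicative (ZMod l)) ∧
        Subsingleton (T.autK (T.tp T.PiCu))) ∧
      (T.Prop26 → T.Rmk261_dotted) := by
  obtain ⟨eX⟩ := nonempty_oncePuncturedData_modelχ' p
  have hK : (MuTwoSetting.inversionModelχ' p).barKerTp l ≤ C.Huu := hC ▸ barKerTp_le_Huuχ_inversionModelχ' p l hodd
  have hsH : ∀ σ, sectionχ' p σ ∈ C.Huu := fun σ => by rw [hC]; exact inr_mem_Huuχ p l σ
  have hMuL := hasMuL_coverOfRecordχ' p hodd hl C eX hK hsH (iotaStable_conjX_epsPMInvχ' p C hC)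
  refine ⟨_, rfl, (cLevelDataInvχ' p).nonempty_orbitEmbeddingOfHuuOfSection _ _ _ eX hodd _ _ _ _ _ _ C hK hsH _ _ τ τ',
    hMuL, ?_, fun h26 => ?_⟩
  · exact (cLevelDataInvχ' p).temperedCoverDataOfHuuOfSection_rmk261 _ _ _ eX hodd _ _ _ _ _ _ C hK hsH _ _ hMuL
  · exact (cLevelDataInvχ' p).temperedCoverDataOfHuuOfSection_rmk261_dotted_of_slimX _ _ _ eX hodd hl1 _ _ _ _ _ _ C hK
      hsH _ _ (isSlimGroup_PiTpχ_holds p) h26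

end SettingModel

end Literature.AnabelianGeometry.EtaleTheta

end
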